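import Literature.AlgebraicGeometry.Frobenioids.PadicFrobenioidPerfection
import Literature.AlgebraicGeometry.Frobenioids.PadicFrobenioidZeroMonoid
import HarnessLib

/-!
# Frobenioids II, Example 1.1 (ii): `Φ`, `B` are monoids on `D` for a subfunctor datum — the perfection `C_v`

Mochizuki, *The geometry of Frobenioids II*, Kyushu J. Math. **62** (2008) 401–460, §1, Example 1.1 (ii), p. 8
("`Φ ⊆ Φ₀|_D` a monoprime subfunctor in monoids … `B := B₀|_D ×_{Φ₀^gp|_D} Φ^gp`", so that [FrdI] Thm. 5.2
applies: "`Φ`, `B` monoids on `D`", [FrdI] Def. 1.1 (ii)) [cite: MochizukiFrdII2008, Ex 1.1 (ii) p.8].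

PROOF-ONLY companion of `PadicFrobenioidSubfunctor.lean` / `PadicFrobenioidPerfection.lean` (abc-iut-L1-t4):
for every `SubDatum` over a base `D → D₀` of `p`-adic local fields OF FSM-TYPE, the standing hypothesis
`Datum.IsMonoidData` of the Theorem 1.2 facts HOLDS for `SubDatum.toDatum` — pull-backs of `Φ ⊆ Φ₀|_D` are
restrictions of the injective `Φ₀(f)` (abc-iut-L1-d8's `Realification.map_injective_of_isZMonoprime`) into sharp
monoids, those of `B` are injective (`toDatum_map_B_injective`), and FSM-morphisms of `D` are isomorphisms:

* `SubDatum.isMonoidOn_Φ`, `SubDatum.isMonoidOn_B`, `SubDatum.toDatum_isMonoidData`;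
* `Datum.perf_isMonoidData` — for the perfection datum `Φ = ord(O^⊳)^pf` ([IUTchI] Ex. 3.3 (i) `C_v`).
-/

noncomputable section

namespace Literature.AlgebraicGeometry.Frobenioids

namespace PadicFrd

open CategoryTheory Opposite Function

universe v u

variable {D : Type u} [Category.{v} D] {p : ℕ} [Fact p.Prime] {base : D ⥤ PadicFld.{u} p} (T : SubDatum base)
  (hloc : ∀ A : D, (base.obj A).IsPadicLocal) (hc : IsConnected D) (he : IsTotallyEpimorphic D)

namespace SubDatum

/-- The underlying map of an isomorphism of `CommMonCat` is bijective. [cite: MochizukiFrdI2008, Def. 1.1(ii) p.19] -/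
private theorem bijective_hom_of_isIso {X Y : CommMonCat.{u}} (f : X ⟶ Y) [IsIso f] : Bijective f.hom := by
  refine Function.bijective_iff_has_inverse.mpr ⟨(inv f).hom, fun x => ?_, fun y => ?_⟩
  · change (f ≫ inv f).hom x = x
    rw [IsIso.hom_inv_id]
    rfl
  · change (inv f ≫ f).hom y = y
    rw [IsIso.inv_hom_id]
    rfl

/-- The pull-back maps of `Φ ⊆ Φ₀|_D` are injective: restrictions of the injective `Φ₀(f)` (`ord(O^⊳) → ord(O^⊳)`
injective along a valuative field homomorphism, realified between `ℤ`-monoprime monoids).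
[cite: MochizukiFrdII2008, Ex 1.1 (ii) p.8] -/
theorem toDatum_map_Φ_injective {A A' : D} (g : A' ⟶ A) :
    Injective ((T.toDatum hloc hc he).Φ.map g.op).hom := by
  obtain ⟨⟨instA, hfinA, hcA⟩⟩ := hloc A
  obtain ⟨⟨instA', hfinA', hcA'⟩⟩ := hloc A'
  have hZ : IsZMonoprime (OrdInt (base.obj A).K) := by
    letI := instA; haveI := hfinA; exact isZMonoprime_ordInt hcA
  have hZ' : IsZMonoprime (OrdInt (base.obj A').K) := by
    letI := instA'; haveI := hfinA'; exact isZMonoprime_ordInt hcA'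
  have hinj : Injective (phi0Map base g.op) :=
    Realification.map_injective_of_isZMonoprime hZ hZ' _ (ordIntMapOfHom_injective _ _)
  intro x y h
  exact Subtype.ext (hinj (congrArg Subtype.val h))

/-- `Φ ⊆ Φ₀|_D` is a monoid on `D` over a base of FSM-type ([FrdI] Def. 1.1 (ii)): injective pull-backs into sharp
(monoprime) monoids are characteristically injective; FSM-morphisms are isomorphisms. [cite: MochizukiFrdII2008, Ex 1.1 (ii) p.8] -/
theorem isMonoidOn_Φ (hD : IsOfFSMType D) : IsMonoidOn (T.toDatum hloc hc he).Φ := by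
  refine ⟨fun {A B} g => ?_, fun {A B} g hg => ?_⟩
  · exact isCharInjective_of_injective_of_isSharp _ (T.toDatum_map_Φ_injective hloc hc he g)
      ((T.toDatum hloc hc he).isMonoprime (op B)).isSharp
  · haveI : IsIso g := hD.isIso_of_isFSM g hg
    haveI : IsIso ((T.toDatum hloc hc he).Φ.map g.op) := inferInstance
    exact bijective_hom_of_isIso _

/-- `B = B₀|_D ×_{Φ₀^gp} Φ^gp` is a monoid on `D` over a base of FSM-type (`B(A)` is a group, so its
characteristic is trivial). [cite: MochizukiFrdII2008, Ex 1.1 (ii) p.8] -/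
theorem isMonoidOn_B (hD : IsOfFSMType D) : IsMonoidOn (T.toDatum hloc hc he).B := by
  refine ⟨fun {A B} g => ⟨T.toDatum_map_B_injective hloc hc he g, ?_⟩, fun {A B} g hg => ?_⟩
  · haveI : Subsingleton (Associates ((T.toDatum hloc hc he).B.obj (op A))) := ⟨fun x y => by
      obtain ⟨a, rfl⟩ := Associates.mk_surjective x
      obtain ⟨b, rfl⟩ := Associates.mk_surjective y
      obtain ⟨ua, hua⟩ := (T.toDatum hloc hc he).isUnit_B (op A) a
      obtain ⟨ub, hub⟩ := (T.toDatum hloc hc he).isUnit_B (op A) b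
      exact Associates.mk_eq_mk_iff_associated.mpr
        ⟨ua⁻¹ * ub, by rw [← hua, Units.val_mul, ← mul_assoc, Units.mul_inv, one_mul, hub]⟩⟩
    exact injective_of_subsingleton _
  · haveI : IsIso g := hD.isIso_of_isFSM g hg
    haveI : IsIso ((T.toDatum hloc hc he).B.map g.op) := inferInstance
    exact bijective_hom_of_isIso _

/-- **`IsMonoidData` for the datum of a subfunctor** over a base of FSM-type: "`Φ`, `B` are monoids on `D`".
[cite: MochizukiFrdII2008, Ex 1.1 (ii) p.8] -/
theorem toDatum_isMonoidData (hD : IsOfFSMType D) : (T.toDatum hloc hc he).IsMonoidData :=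
  ⟨T.isMonoidOn_Φ hloc hc he hD, T.isMonoidOn_B hloc hc he hD⟩

end SubDatum

/-- **`IsMonoidData` for the perfection datum `Φ = ord(O^⊳)^pf`** ([IUTchI] Ex. 3.3 (i) `C_v`) over a base of
FSM-type. [cite: MochizukiFrdII2008, Ex 1.1 (ii) p.8] -/
theorem Datum.perf_isMonoidData (base : D ⥤ PadicFld.{u} p) (hloc : ∀ A : D, (base.obj A).IsPadicLocal)
    (hc : IsConnected D) (he : IsTotallyEpimorphic D) (hD : IsOfFSMType D) :
    (Datum.perf base hloc hc he).IsMonoidData :=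
  (perfSubDatum base hloc).toDatum_isMonoidData hloc hc he hD

end PadicFrd

end Literature.AlgebraicGeometry.Frobenioids
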